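import Literature.Computability.Complexity.HardcoreInapproximabilityFirstMoment
import Literature.Computability.Complexity.HardcoreInapproximabilityTrees
import Literature.Computability.Complexity.HardcoreInapproximabilityFirstMomentCount
import HarnessLib

/-!
# Sly (2010), Theorem 3.10 — the lower tail of the phase partition functions of the core

From the per-slice lower tail of Lemma 3.9 (as a hypothesis here; proved in
`HardcoreInapproximabilitySSCSlice` / `…Holds`) to the counting form of Theorem 3.10 used by
`slyGadgetReduction_of_thm310`:
* the involution `ω ↦ ω⁻¹` of the realisations (`slyInvReal`, `slyZab_inv`): the minus phase of the
  boundary `(E⁺, E⁻)` is the strict plus phase of `(E⁻, E⁺)` at the inverse realisation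
  (`slyCoreZ_false_eq_slyTsum`), the plus phase is the non-strict weighted slice sum
  (`slyCoreZ_true_eq_slyTsum`);
* a weighted Markov inequality over the `n^{-1/(2ℓ)}`-window around `(p⁺ n, p⁻ n)`
  (`card_weighted_markov`) and the off-window first-moment decay `sly_offWindow_pointwise` give
  `sly_Tsum_lowerTail_of_slice`: `16 · #{ω : |Ω| T(ω) < (Σ T)/√n} ≤ |Ω|`;
* with the densities of `exists_slyCriticalDensities` and the extra condition `sly_extraCondition`,
  both phases follow (`sly_HT6_of_perSlice`);
* glue for the per-slice inputs: the window regime (`sly_window_regime`), positivity of the first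
  moment (`sly_sum_slyZab_pos_window`) and the second-moment input from the ratio identity and the
  ratio bound (`sly_secondMoment_input`).

## References
* [Sly2010] A. Sly, *Computational transition at the uniqueness threshold*, FOCS 2010,
  arXiv:1005.5584, Theorem 3.10 and its proof, Lemma 3.9.
-/

namespace Literature.Computability.Complexity

open Finset Real Filter Topology Literature.Probability.LatticeModels
open scoped Nat

section Involution

variable {n m' q : ℕ}

/-- The inverse realisation `(σ⁻¹, τ⁻¹)`. [folklore] -/
def slyInvReal (ω : (Fin q → Equiv.Perm (Fin (n + m'))) × Equiv.Perm (Fin n)) :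
    (Fin q → Equiv.Perm (Fin (n + m'))) × Equiv.Perm (Fin n) :=
  (fun i => (ω.1 i)⁻¹, ω.2⁻¹)

/-- `slyInvReal` is an involution. [folklore] -/
theorem slyInvReal_invol (ω : (Fin q → Equiv.Perm (Fin (n + m'))) × Equiv.Perm (Fin n)) :
    slyInvReal (slyInvReal ω) = ω := by
  unfold slyInvReal; simp

/-- `slyInvReal` as a permutation of the realisations. [folklore] -/
def slyInvEquiv (n m' q : ℕ) : ((Fin q → Equiv.Perm (Fin (n + m'))) × Equiv.Perm (Fin n)) ≃
    ((Fin q → Equiv.Perm (Fin (n + m'))) × Equiv.Perm (Fin n)) where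
  toFun := slyInvReal
  invFun := slyInvReal
  left_inv := slyInvReal_invol
  right_inv := slyInvReal_invol

/-- **Independence is symmetric under inverting the matchings and swapping the halves.** [folklore] -/
theorem slyCoreIndep_inv_iff (σ : Fin q → Equiv.Perm (Fin (n + m'))) (τ : Equiv.Perm (Fin n))
    (S T : Finset (Fin n)) (Ep Em : Finset (Fin m')) :
    SlyCoreIndep σ τ S T Ep Em ↔ SlyCoreIndep (fun i => (σ i)⁻¹) τ⁻¹ T S Em Ep := by
  unfold SlyCoreIndep
  constructor
  · rintro ⟨h1, h2⟩
    refine ⟨fun i w hw hv => h1 i _ hv (by simpa using hw), fun t ht hs => h2 _ hs (by simpa using ht)⟩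
  · rintro ⟨h1, h2⟩
    refine ⟨fun i v hv hw => h1 i _ hw (by simpa using hv), fun s hs ht => h2 _ ht (by simpa using hs)⟩

open scoped Classical in
/-- **The slice counts under the involution**: `Z_{a,b}(E⁺,E⁻)(ω) = Z_{b,a}(E⁻,E⁺)(ω⁻¹)`. [folklore] -/
theorem slyZab_inv (a b : ℕ) (Ep Em : Finset (Fin m')) (ω : (Fin q → Equiv.Perm (Fin (n + m'))) × Equiv.Perm (Fin n)) :
    slyZab n m' q a b Ep Em ω = slyZab n m' q b a Em Ep (slyInvReal ω) := by
  unfold slyZab slyInvReal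
  refine Finset.card_bij (fun ST _ => (ST.2, ST.1)) ?_ ?_ ?_
  · intro ST hST
    rw [Finset.mem_filter, Finset.mem_product] at hST ⊢
    exact ⟨⟨hST.1.2, hST.1.1⟩, (slyCoreIndep_inv_iff _ _ _ _ _ _).1 hST.2⟩
  · intro ST _ ST' _ h
    simp only [Prod.mk.injEq] at h
    exact Prod.ext h.2 h.1
  · intro TS hTS
    rw [Finset.mem_filter, Finset.mem_product] at hTS
    refine ⟨(TS.2, TS.1), ?_, rfl⟩
    rw [Finset.mem_filter, Finset.mem_product]
    refine ⟨⟨hTS.1.2, hTS.1.1⟩, ?_⟩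
    rw [slyCoreIndep_inv_iff]
    simpa using hTS.2

end Involution

section WeightedSlices

variable {n m' q : ℕ}

/-- **The λ-weighted slice sum of a phase-type region**: `T_strict(ω) = Σ_a Σ_{b < a (or ≤ a)} λ^{a+b+|E⁺|+|E⁻|} Z_{a,b}(ω)`
(`strict = false` is Sly's `Z⁺_{G̃}(η)` realised at `ω`; `strict = true` drops the diagonal). [cite: Sly2010, §3 (definition of `Z^{±}_{G̃}(η)`)] -/
noncomputable def slyTsum (n m' q : ℕ) (lam : ℝ) (strict : Bool) (Ep Em : Finset (Fin m'))
    (ω : (Fin q → Equiv.Perm (Fin (n + m'))) × Equiv.Perm (Fin n)) : ℝ :=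
  ∑ a ∈ range (n + 1), ∑ b ∈ range (if strict then a else a + 1),
    lam ^ (a + b + Ep.card + Em.card) * (slyZab n m' q a b Ep Em ω : ℝ)

open scoped Classical in
/-- The inner configuration sums are `λ^{…} Z_{a,b}`. [folklore] -/
theorem sum_powersetCard_indep_eq (σ : Fin q → Equiv.Perm (Fin (n + m'))) (τ : Equiv.Perm (Fin n))
    (lam : ℝ) (Ep Em : Finset (Fin m')) (a b : ℕ) :
    ∑ S ∈ (univ : Finset (Fin n)).powersetCard a, ∑ T ∈ (univ : Finset (Fin n)).powersetCard b,
        (if SlyCoreIndep σ τ S T Ep Em then lam ^ (a + b + Ep.card + Em.card) else 0) =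
      lam ^ (a + b + Ep.card + Em.card) * (slyZab n m' q a b Ep Em (σ, τ) : ℝ) := by
  unfold slyZab
  rw [Finset.card_filter, Nat.cast_sum, Finset.mul_sum, Finset.sum_product]
  refine Finset.sum_congr rfl fun S _ => Finset.sum_congr rfl fun T _ => ?_
  split_ifs <;> simp

/-- **Phase `+` is the non-strict weighted slice sum.** [cite: Sly2010, §3] -/
theorem slyCoreZ_true_eq_slyTsum (lam : ℝ) (Ep Em : Finset (Fin m')) (ω : (Fin q → Equiv.Perm (Fin (n + m'))) × Equiv.Perm (Fin n)) :
    slyCoreZ ω.1 ω.2 lam true Ep Em = slyTsum n m' q lam false Ep Em ω := by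
  rw [slyCoreZ_true_eq]
  unfold slyTsum
  simp only [Bool.false_eq_true, if_false]
  refine Finset.sum_congr rfl fun a _ => Finset.sum_congr rfl fun b _ => ?_
  exact sum_powersetCard_indep_eq ω.1 ω.2 lam Ep Em a b

/-- **Phase `-` is the strict weighted slice sum of the swapped boundary at the inverse realisation.**
[cite: Sly2010, §3 (the asymmetry of `Z⁺`/`Z⁻`)] -/
theorem slyCoreZ_false_eq_slyTsum (lam : ℝ) (Ep Em : Finset (Fin m')) (ω : (Fin q → Equiv.Perm (Fin (n + m'))) × Equiv.Perm (Fin n)) :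
    slyCoreZ ω.1 ω.2 lam false Ep Em = slyTsum n m' q lam true Em Ep (slyInvReal ω) := by
  rw [slyCoreZ_false_eq]
  unfold slyTsum
  simp only [if_true]
  -- rewrite the inner sums, then exchange `a < b`
  rw [Finset.sum_congr rfl fun a _ => Finset.sum_congr rfl fun b _ => sum_powersetCard_indep_eq ω.1 ω.2 lam Ep Em a b]
  rw [Finset.sum_sigma', Finset.sum_sigma']
  refine Finset.sum_bij' (fun x _ => ⟨x.2, x.1⟩) (fun x _ => ⟨x.2, x.1⟩) ?_ ?_ ?_ ?_ ?_
  · intro x hx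
    rw [Finset.mem_sigma, Finset.mem_range, Finset.mem_Ioc] at hx
    rw [Finset.mem_sigma, Finset.mem_range, Finset.mem_range]
    dsimp only
    omega
  · intro x hx
    rw [Finset.mem_sigma, Finset.mem_range, Finset.mem_range] at hx
    rw [Finset.mem_sigma, Finset.mem_range, Finset.mem_Ioc]
    dsimp only
    omega
  · intro x _; rfl
  · intro x _; rfl
  · intro x _
    dsimp only
    rw [slyZab_inv, show x.1 + x.2 + Ep.card + Em.card = x.2 + x.1 + Em.card + Ep.card by ring]

/-- Sums over the realisations are invariant under the involution. [folklore] -/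
theorem sum_slyInvReal_comp {M : Type*} [AddCommMonoid M] (f : ((Fin q → Equiv.Perm (Fin (n + m'))) × Equiv.Perm (Fin n)) → M) :
    ∑ ω, f (slyInvReal ω) = ∑ ω, f ω :=
  Equiv.sum_comp (slyInvEquiv n m' q) f

open scoped Classical in
/-- Counting over the realisations is invariant under the involution. [folklore] -/
theorem card_filter_slyInvReal_comp (P : ((Fin q → Equiv.Perm (Fin (n + m'))) × Equiv.Perm (Fin n)) → Prop) :
    (univ.filter fun ω => P (slyInvReal ω)).card = (univ.filter fun ω => P ω).card := by
  rw [Finset.card_filter, Finset.card_filter]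
  exact Equiv.sum_comp (slyInvEquiv n m' q) (fun ω => if P ω then 1 else 0)

end WeightedSlices

section Markov

variable {Ω ι : Type*} [Fintype Ω]

/-- **Weighted Markov over a window**: if every index `p ∈ W` has `#{ω | bad ω p} ≤ θ N`, then
`#{ω | c · Σ_W F ≤ Σ_{p ∈ W} F_p 1[bad ω p]} · (c Σ_W F) ≤ θ N Σ_W F`. [folklore] -/
theorem card_weighted_markov (W : Finset ι) (F : ι → ℝ) (hF : ∀ p ∈ W, 0 ≤ F p) (bad : Ω → ι → Prop)
    [∀ ω p, Decidable (bad ω p)] {θ N c : ℝ}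
    (hbad : ∀ p ∈ W, ((univ.filter fun ω => bad ω p).card : ℝ) ≤ θ * N) :
    haveI := Classical.decPred fun ω : Ω => c * ∑ p ∈ W, F p ≤ ∑ p ∈ W, (if bad ω p then F p else 0)
    ((univ.filter fun ω : Ω => c * ∑ p ∈ W, F p ≤ ∑ p ∈ W, (if bad ω p then F p else 0)).card : ℝ) * (c * ∑ p ∈ W, F p) ≤
      θ * N * ∑ p ∈ W, F p := by
  letI := Classical.decPred fun ω : Ω => c * ∑ p ∈ W, F p ≤ ∑ p ∈ W, (if bad ω p then F p else 0)
  set B := univ.filter fun ω : Ω => c * ∑ p ∈ W, F p ≤ ∑ p ∈ W, (if bad ω p then F p else 0) with hB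
  have hterm0 : ∀ ω, 0 ≤ ∑ p ∈ W, (if bad ω p then F p else 0) := fun ω =>
    Finset.sum_nonneg fun p hp => by split_ifs <;> [exact hF p hp; exact le_rfl]
  calc (B.card : ℝ) * (c * ∑ p ∈ W, F p) = ∑ _ω ∈ B, c * ∑ p ∈ W, F p := by rw [Finset.sum_const, nsmul_eq_mul]
    _ ≤ ∑ ω ∈ B, ∑ p ∈ W, (if bad ω p then F p else 0) := Finset.sum_le_sum fun ω hω => (Finset.mem_filter.1 hω).2
    _ ≤ ∑ ω, ∑ p ∈ W, (if bad ω p then F p else 0) :=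
        Finset.sum_le_sum_of_subset_of_nonneg (Finset.filter_subset _ _) fun ω _ _ => hterm0 ω
    _ = ∑ p ∈ W, F p * ((univ.filter fun ω => bad ω p).card : ℝ) := by
        rw [Finset.sum_comm]
        refine Finset.sum_congr rfl fun p _ => ?_
        rw [Finset.card_filter, Nat.cast_sum, Finset.mul_sum]
        refine Finset.sum_congr rfl fun ω _ => ?_
        split_ifs <;> simp
    _ ≤ ∑ p ∈ W, F p * (θ * N) := Finset.sum_le_sum fun p hp => mul_le_mul_of_nonneg_left (hbad p hp) (hF p hp)
    _ = θ * N * ∑ p ∈ W, F p := by rw [← Finset.sum_mul]; ring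

end Markov

section Thm310

variable {n m' q : ℕ}

/-- The number of realisations. [folklore] -/
private theorem card_realisations' (n m' q : ℕ) :
    (Fintype.card ((Fin q → Equiv.Perm (Fin (n + m'))) × Equiv.Perm (Fin n)) : ℝ) =
      ((n + m').factorial : ℝ) ^ q * (n.factorial : ℝ) := by
  rw [Fintype.card_prod, Fintype.card_fun, Fintype.card_perm, Fintype.card_perm, Fintype.card_fin, Fintype.card_fin,
    Fintype.card_fin]
  push_cast; ring

/-- The number of realisations is positive. [folklore] -/
private theorem card_realisations_pos' (n m' q : ℕ) : (0 : ℝ) < ((n + m').factorial : ℝ) ^ q * (n.factorial : ℝ) := by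
  have h1 : (0 : ℝ) < (n + m').factorial := by exact_mod_cast Nat.factorial_pos _
  have h2 : (0 : ℝ) < n.factorial := by exact_mod_cast Nat.factorial_pos _
  positivity

/-- The phase-type index region `{(a,b) : a, b ≤ n, b < a (or b ≤ a)}`. [folklore] -/
def slyRegion (n : ℕ) (strict : Bool) : Finset (ℕ × ℕ) :=
  ((range (n + 1)) ×ˢ (range (n + 1))).filter fun p => if strict then p.2 < p.1 else p.2 ≤ p.1

/-- The weighted slice sum over the region. [folklore] -/
theorem slyTsum_eq_sum_region (lam : ℝ) (strict : Bool) (Ep Em : Finset (Fin m'))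
    (ω : (Fin q → Equiv.Perm (Fin (n + m'))) × Equiv.Perm (Fin n)) :
    slyTsum n m' q lam strict Ep Em ω =
      ∑ p ∈ slyRegion n strict, lam ^ (p.1 + p.2 + Ep.card + Em.card) * (slyZab n m' q p.1 p.2 Ep Em ω : ℝ) := by
  unfold slyTsum slyRegion
  rw [Finset.sum_filter, Finset.sum_product]
  refine Finset.sum_congr rfl fun a ha => ?_
  rw [Finset.mem_range] at ha
  rw [← Finset.sum_filter]
  congr 1
  ext b
  simp only [Finset.mem_range, Finset.mem_filter]
  cases strict <;> simp <;> omega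

/-- **The λ-weighted first moment of a slice**: `λ^{a+b+|E⁺|+|E⁻|} Σ_ω Z_{a,b}(ω) = |Ω| · slyF n m' q λ a b |E⁺| |E⁻|`
(`a, b ≤ n`). [cite: Sly2010, proof of Lemma 3.1] -/
theorem weight_mul_sum_slyZab_eq (lam : ℝ) {a b : ℕ} (ha : a ≤ n) (hb : b ≤ n) (Ep Em : Finset (Fin m')) :
    lam ^ (a + b + Ep.card + Em.card) * ∑ ω : (Fin q → Equiv.Perm (Fin (n + m'))) × Equiv.Perm (Fin n), (slyZab n m' q a b Ep Em ω : ℝ) =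
      (Fintype.card ((Fin q → Equiv.Perm (Fin (n + m'))) × Equiv.Perm (Fin n)) : ℝ) * slyF n m' q lam a b Ep.card Em.card := by
  have hep : Ep.card ≤ m' := by simpa using Finset.card_le_univ Ep
  have hem : Em.card ≤ m' := by simpa using Finset.card_le_univ Em
  rw [sum_slyZab_eq n m' q a b Ep Em ha hb (by omega) (by omega), card_realisations', slyF_def]
  ring

end Thm310

section Thm310Main

variable {q : ℕ}

set_option maxHeartbeats 1600000 in
open scoped Classical in
/-- **Sly's Theorem 3.10 for the plus-type weighted slice sums, from the per-slice lower tail**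
(Lemma 3.9 as hypothesis `Hslice`): a weighted Markov inequality over the `n^{-1/(2ℓ)}`-window around
`(p⁺ n, p⁻ n)` and the off-window first-moment decay (`sly_offWindow_pointwise`) give, for `n ≥ n₆`
and `m' ≤ n^{γ}`, `16 · #{ω : |Ω| T(ω) < (Σ_{ω'} T(ω'))/√n} ≤ |Ω|` for `T = slyTsum n m' q λ strict E⁺ E⁻`,
both with and without the diagonal. [cite: Sly2010, Theorem 3.10 (proof)] -/
theorem sly_Tsum_lowerTail_of_slice (q : ℕ) (hq : 2 ≤ q) {lam pp pm : ℝ} (hlam : hardCoreThreshold (q + 1) < lam)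
    (hpm : 0 < pm) (hlt : pm < pp) (hsum : pp + pm < 1)
    (hEα : lam * (1 - pp - pm) ^ (q + 1) = pp * (1 - pp) ^ (q + 1 - 1))
    (hEβ : lam * (1 - pp - pm) ^ (q + 1) = pm * (1 - pm) ^ (q + 1 - 1))
    (Hslice : ∃ χ : ℝ, 0 < χ ∧ ∃ n₀ : ℕ, ∀ n : ℕ, n₀ ≤ n → ∀ m' : ℕ, (m' : ℝ) ≤ (n : ℝ) ^ (1 / 10 : ℝ) →
      ∀ (Ep Em : Finset (Fin m')) (a b : ℕ), |(a : ℝ) / n - pp| ≤ χ → |(b : ℝ) / n - pm| ≤ χ →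
        ((univ.filter fun ω : (Fin q → Equiv.Perm (Fin (n + m'))) × Equiv.Perm (Fin n) =>
            ((slyZab n m' q a b Ep Em ω : ℕ) : ℝ) ≤ 2 / Real.sqrt n *
              ((∑ ω' : (Fin q → Equiv.Perm (Fin (n + m'))) × Equiv.Perm (Fin n), ((slyZab n m' q a b Ep Em ω' : ℕ) : ℝ)) /
                Fintype.card ((Fin q → Equiv.Perm (Fin (n + m'))) × Equiv.Perm (Fin n)))).card : ℝ) ≤
          1 / 64 * Fintype.card ((Fin q → Equiv.Perm (Fin (n + m'))) × Equiv.Perm (Fin n))) :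
    ∃ γ : ℝ, 0 < γ ∧ ∃ n₆ : ℕ, ∀ n : ℕ, n₆ ≤ n → ∀ m' : ℕ, (m' : ℝ) ≤ (n : ℝ) ^ γ →
      ∀ (strict : Bool) (Ep Em : Finset (Fin m')),
        16 * ((univ.filter fun ω : (Fin q → Equiv.Perm (Fin (n + m'))) × Equiv.Perm (Fin n) =>
          (Fintype.card ((Fin q → Equiv.Perm (Fin (n + m'))) × Equiv.Perm (Fin n)) : ℝ) * slyTsum n m' q lam strict Ep Em ω <
            (∑ ω' : (Fin q → Equiv.Perm (Fin (n + m'))) × Equiv.Perm (Fin n), slyTsum n m' q lam strict Ep Em ω') /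
              Real.sqrt n).card : ℝ) ≤
          Fintype.card ((Fin q → Equiv.Perm (Fin (n + m'))) × Equiv.Perm (Fin n)) := by
  have hd : 3 ≤ q + 1 := by omega
  have hlam0 : 0 < lam := (hardCoreThreshold_pos hd).trans hlam
  have hpp : 0 < pp := hpm.trans hlt
  have hu0 : 0 < 1 - pp - pm := by linarith
  -- the off-window lemma and the window geometry
  obtain ⟨ℓ, hℓ, hoffε⟩ := sly_offWindow_pointwise (d := q + 1) hd hlam hpm hlt hsum hEα hEβ
  simp only [Nat.add_sub_cancel] at hoffε
  obtain ⟨n₀, hn₀⟩ := hoffε (1 / 2) (by norm_num)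
  obtain ⟨n₁, hn₁⟩ := sly_window_eventually hpm hlt hsum hℓ one_pos q
  obtain ⟨χ, hχ, n₂, hn₂⟩ := Hslice
  have hℓR : (1 : ℝ) ≤ ℓ := by exact_mod_cast hℓ
  -- `ρ_n ≤ χ` eventually
  have hρχ : ∃ n₃ : ℕ, ∀ n : ℕ, n₃ ≤ n → (n : ℝ) ^ (-(1 / (2 * (ℓ : ℝ)))) ≤ χ := by
    have T := (tendsto_rpow_neg_atTop (show (0:ℝ) < 1 / (2 * (ℓ : ℝ)) by positivity)).comp tendsto_natCast_atTop_atTop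
    obtain ⟨n₃, hn₃⟩ := Filter.eventually_atTop.1 (T.eventually_le_const hχ)
    exact ⟨n₃, fun n hn => hn₃ n hn⟩
  obtain ⟨n₃, hn₃⟩ := hρχ
  set γ : ℝ := min (1 / 10) (1 / (5 * (ℓ : ℝ))) with hγ
  have hγ0 : 0 < γ := lt_min (by norm_num) (by positivity)
  refine ⟨γ, hγ0, max (max n₀ n₁) (max n₂ n₃), ?_⟩
  intro n hn m' hm' strict Ep Em
  have hnn₀ : n₀ ≤ n := le_trans (le_trans (le_max_left _ _) (le_max_left _ _)) hn
  have hnn₁ : n₁ ≤ n := le_trans (le_trans (le_max_right _ _) (le_max_left _ _)) hn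
  have hnn₂ : n₂ ≤ n := le_trans (le_trans (le_max_left _ _) (le_max_right _ _)) hn
  have hnn₃ : n₃ ≤ n := le_trans (le_trans (le_max_right _ _) (le_max_right _ _)) hn
  obtain ⟨hρgeom, hinvρ, h8, -, hn1⟩ := hn₁ n hnn₁
  have hn1R : (1 : ℝ) ≤ n := by exact_mod_cast hn1
  have hn0 : (0 : ℝ) < n := by linarith
  set ρ : ℝ := (n : ℝ) ^ (-(1 / (2 * (ℓ : ℝ)))) with hρ
  have hρχ' : ρ ≤ χ := hn₃ n hnn₃
  -- the two exponent comparisons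
  have hm'10 : (m' : ℝ) ≤ (n : ℝ) ^ (1 / 10 : ℝ) :=
    hm'.trans (Real.rpow_le_rpow_of_exponent_le hn1R (min_le_left _ _))
  have hm'ℓ : (m' : ℝ) ≤ (n : ℝ) ^ (1 / (5 * (ℓ : ℝ))) :=
    hm'.trans (Real.rpow_le_rpow_of_exponent_le hn1R (min_le_right _ _))
  have hep : Ep.card ≤ m' := by simpa using Finset.card_le_univ Ep
  have hem : Em.card ≤ m' := by simpa using Finset.card_le_univ Em
  -- notation
  set Ωt := (Fin q → Equiv.Perm (Fin (n + m'))) × Equiv.Perm (Fin n)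
  set N : ℝ := (Fintype.card Ωt : ℝ) with hN
  have hNpos : 0 < N := by rw [hN, card_realisations']; exact card_realisations_pos' n m' q
  set w : ℕ × ℕ → ℝ := fun p => lam ^ (p.1 + p.2 + Ep.card + Em.card) with hw
  have hw0 : ∀ p, 0 < w p := fun p => pow_pos hlam0 _
  set Zr : Ωt → ℕ × ℕ → ℝ := fun ω p => ((slyZab n m' q p.1 p.2 Ep Em ω : ℕ) : ℝ) with hZr
  have hZr0 : ∀ ω p, 0 ≤ Zr ω p := fun ω p => Nat.cast_nonneg _
  set F : ℕ × ℕ → ℝ := fun p => w p * ∑ ω, Zr ω p with hF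
  have hF0 : ∀ p, 0 ≤ F p := fun p => mul_nonneg (hw0 p).le (Finset.sum_nonneg fun ω _ => hZr0 ω p)
  set P2 : Finset (ℕ × ℕ) := (range (n + 1)) ×ˢ (range (n + 1)) with hP2
  set Wset : Finset (ℕ × ℕ) := P2.filter fun p => |(p.1 : ℝ) / n - pp| ≤ ρ ∧ |(p.2 : ℝ) / n - pm| ≤ ρ with hWset
  set Rset : Finset (ℕ × ℕ) := slyRegion n strict with hRset
  -- `F p = N · slyF` on `P2`
  have hFP2 : ∀ p ∈ P2, F p = N * slyF n m' q lam p.1 p.2 Ep.card Em.card := by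
    intro p hp
    rw [hP2, Finset.mem_product, Finset.mem_range, Finset.mem_range] at hp
    exact weight_mul_sum_slyZab_eq lam (by omega) (by omega) Ep Em
  -- the window lies in the strict region
  have hgeom : ∀ p ∈ Wset, p.2 < p.1 := by
    intro p hp
    rw [hWset, Finset.mem_filter] at hp
    obtain ⟨-, -, hlt', -⟩ := slyWindow_geometry hlt hρgeom hp.2.1 hp.2.2
    have : (p.2 : ℝ) < p.1 := by
      have h := (div_lt_div_iff_of_pos_right hn0).1 hlt'
      exact h
    exact_mod_cast this
  have hWR : Wset ⊆ Rset := by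
    intro p hp
    have hlt' := hgeom p hp
    rw [hWset, Finset.mem_filter] at hp
    rw [hRset, slyRegion, Finset.mem_filter]
    refine ⟨hp.1, ?_⟩
    cases strict
    · simp only [Bool.false_eq_true, if_false]; exact hlt'.le
    · simp only [if_true]; exact hlt'
  have hRP : Rset ⊆ P2 := by rw [hRset]; unfold slyRegion; exact Finset.filter_subset _ _
  have hWP : Wset ⊆ P2 := Finset.filter_subset _ _
  -- the anchor
  set a₀ : ℕ := ⌊pp * n⌋₊ with ha₀
  set b₀ : ℕ := ⌊pm * n⌋₊ with hb₀
  have ha₀n : a₀ ≤ n := by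
    have h1 : (a₀ : ℝ) ≤ pp * n := Nat.floor_le (by positivity)
    have : (a₀ : ℝ) ≤ n := h1.trans (by nlinarith)
    exact_mod_cast this
  have hb₀n : b₀ ≤ n := by
    have h1 : (b₀ : ℝ) ≤ pm * n := Nat.floor_le (by positivity)
    have : (b₀ : ℝ) ≤ n := h1.trans (by nlinarith)
    exact_mod_cast this
  have hp₀W : (a₀, b₀) ∈ Wset := by
    rw [hWset, Finset.mem_filter, hP2, Finset.mem_product, Finset.mem_range, Finset.mem_range]
    exact ⟨⟨by omega, by omega⟩, (abs_floor_div_sub_le hpp.le hn1).trans hinvρ, (abs_floor_div_sub_le hpm.le hn1).trans hinvρ⟩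
  -- off-window terms
  have hoff : ∀ p ∈ Rset \ Wset, F p ≤ (1 / 2) / ((n : ℝ) + 1) ^ 2 * F (a₀, b₀) := by
    intro p hp
    rw [Finset.mem_sdiff] at hp
    have hpP := hRP hp.1
    have hpR := hp.1
    rw [hRset, slyRegion, Finset.mem_filter] at hpR
    rw [hP2, Finset.mem_product, Finset.mem_range, Finset.mem_range] at hpP
    have hle : p.2 ≤ p.1 := by
      cases strict
      · simpa using hpR.2
      · have : p.2 < p.1 := by simpa using hpR.2
        exact this.le
    rw [hFP2 p (hRP hp.1), hFP2 (a₀, b₀) (hWP hp₀W)]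
    by_cases hab : p.1 + p.2 ≤ n
    · -- both window conditions fail
      have c1 : ρ < max |(p.1 : ℝ) / n - pp| |(p.2 : ℝ) / n - pm| := by
        by_contra hc
        push Not at hc
        apply hp.2
        rw [hWset, Finset.mem_filter]
        exact ⟨hRP hp.1, le_trans (le_max_left _ _) hc, le_trans (le_max_right _ _) hc⟩
      have c2 : ρ < max |(p.1 : ℝ) / n - pm| |(p.2 : ℝ) / n - pp| := by
        by_contra hc
        push Not at hc
        -- the swapped window forces `a < b`
        obtain ⟨-, -, hlt', -⟩ := slyWindow_geometry hlt hρgeom (le_trans (le_max_right _ _) hc) (le_trans (le_max_left _ _) hc)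
        have : (p.1 : ℝ) < p.2 := (div_lt_div_iff_of_pos_right hn0).1 hlt'
        have : p.1 < p.2 := by exact_mod_cast this
        omega
      have h := (hn₀ n hnn₀ m' hm'ℓ Ep.card Em.card hep hem p.1 p.2 hab c1 c2).1
      calc N * slyF n m' q lam p.1 p.2 Ep.card Em.card ≤ N * (1 / 2 / ((n : ℝ) + 1) ^ 2 * slyF n m' q lam a₀ b₀ Ep.card Em.card) :=
            mul_le_mul_of_nonneg_left h hNpos.le
        _ = _ := by ring
    · -- `a + b > n`: the term vanishes
      have hz : slyF n m' q lam p.1 p.2 Ep.card Em.card = 0 := by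
        rw [slyF_def]
        have : ((n - p.2).choose p.1 : ℝ) = 0 := by exact_mod_cast Nat.choose_eq_zero_of_lt (by omega)
        rw [this]; simp
      rw [hz, mul_zero]
      have := slyF_nonneg n m' q hlam0.le a₀ b₀ Ep.card Em.card
      positivity
  -- the window mass dominates
  set SW : ℝ := ∑ p ∈ Wset, F p with hSW
  have hSW0 : F (a₀, b₀) ≤ SW := Finset.single_le_sum (fun p _ => hF0 p) hp₀W
  have hFa₀ : 0 < F (a₀, b₀) := by
    rw [hFP2 (a₀, b₀) (hWP hp₀W)]
    refine mul_pos hNpos ?_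
    rw [slyF_def]
    have hsum0 : (a₀ : ℝ) + b₀ + m' ≤ n := by
      have h1 : (a₀ : ℝ) ≤ pp * n := Nat.floor_le (by positivity)
      have h2 : (b₀ : ℝ) ≤ pm * n := Nat.floor_le (by positivity)
      have h3 : (m' : ℝ) ≤ (1 - pp - pm) * n := by
        have := hm'ℓ
        have h8' : 8 * (n : ℝ) ^ (1 / (5 * (ℓ : ℝ))) ≤ (1 - pp - pm) / 2 * n :=
          h8.trans (mul_le_mul_of_nonneg_right (min_le_right _ _) hn0.le)
        nlinarith [Real.rpow_nonneg hn0.le (1 / (5 * (ℓ : ℝ)))]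
      linarith
    have hsumN : a₀ + b₀ + m' ≤ n := by exact_mod_cast hsum0
    have c1 : 0 < (n.choose a₀ : ℝ) := by exact_mod_cast Nat.choose_pos ha₀n
    have c2 : 0 < (n.choose b₀ : ℝ) := by exact_mod_cast Nat.choose_pos hb₀n
    have c3 : 0 < (((n + m' - (b₀ + Em.card)).choose (a₀ + Ep.card) : ℕ) : ℝ) := by
      exact_mod_cast Nat.choose_pos (by omega)
    have c4 : 0 < (((n + m').choose (a₀ + Ep.card) : ℕ) : ℝ) := by exact_mod_cast Nat.choose_pos (by omega)
    have c5 : 0 < (((n - b₀).choose a₀ : ℕ) : ℝ) := by exact_mod_cast Nat.choose_pos (by omega)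
    positivity
  have hSWpos : 0 < SW := lt_of_lt_of_le hFa₀ hSW0
  have hoffsum : ∑ p ∈ Rset \ Wset, F p ≤ (1 / 2) * SW := by
    calc ∑ p ∈ Rset \ Wset, F p ≤ ∑ _p ∈ Rset \ Wset, (1 / 2) / ((n : ℝ) + 1) ^ 2 * F (a₀, b₀) := Finset.sum_le_sum hoff
      _ = ((Rset \ Wset).card : ℝ) * ((1 / 2) / ((n : ℝ) + 1) ^ 2 * F (a₀, b₀)) := by rw [Finset.sum_const, nsmul_eq_mul]
      _ ≤ ((n : ℝ) + 1) ^ 2 * ((1 / 2) / ((n : ℝ) + 1) ^ 2 * F (a₀, b₀)) := by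
          refine mul_le_mul_of_nonneg_right ?_ (by positivity)
          have h1 : (Rset \ Wset).card ≤ P2.card := Finset.card_le_card ((Finset.sdiff_subset).trans hRP)
          have h2 : P2.card = (n + 1) * (n + 1) := by rw [hP2, Finset.card_product, Finset.card_range]
          have : ((Rset \ Wset).card : ℝ) ≤ ((n + 1) * (n + 1) : ℕ) := by exact_mod_cast h2 ▸ h1
          push_cast at this; nlinarith
      _ = (1 / 2) * F (a₀, b₀) := by field_simp
      _ ≤ (1 / 2) * SW := by linarith
  -- the total first moment
  set ET : ℝ := ∑ ω' : Ωt, slyTsum n m' q lam strict Ep Em ω' with hET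
  have hETeq : ET = ∑ p ∈ Rset, F p := by
    rw [hET]
    simp_rw [slyTsum_eq_sum_region]
    rw [Finset.sum_comm]
    refine Finset.sum_congr rfl fun p _ => ?_
    simp only [hF, hw, hZr, Finset.mul_sum]
  have hETle : ET ≤ (3 / 2) * SW := by
    rw [hETeq, ← Finset.sum_sdiff hWR]
    linarith
  -- Markov over the window
  set bad : Ωt → ℕ × ℕ → Prop := fun ω p => Zr ω p ≤ 2 / Real.sqrt n * ((∑ ω', Zr ω' p) / N) with hbad
  have hbadW : ∀ p ∈ Wset, ((univ.filter fun ω => bad ω p).card : ℝ) ≤ 1 / 64 * N := by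
    intro p hp
    rw [hWset, Finset.mem_filter] at hp
    have h := hn₂ n hnn₂ m' hm'10 Ep Em p.1 p.2 (hp.2.1.trans hρχ') (hp.2.2.trans hρχ')
    refine le_trans (le_of_eq ?_) h
    rfl
  have hM := card_weighted_markov (Ω := Ωt) Wset F (fun p _ => hF0 p) bad (c := 1 / 4) (θ := 1 / 64) (N := N) hbadW
  rw [← hSW] at hM
  -- `#B ≤ N/16`
  set Bset := univ.filter fun ω : Ωt => 1 / 4 * SW ≤ ∑ p ∈ Wset, (if bad ω p then F p else 0) with hBset
  have hBcard : 16 * (Bset.card : ℝ) ≤ N := by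
    have h1 : (Bset.card : ℝ) * (1 / 4 * SW) ≤ 1 / 64 * N * SW := hM
    have h2 : (Bset.card : ℝ) * (1 / 4) ≤ 1 / 64 * N := le_of_mul_le_mul_right (by nlinarith) hSWpos
    linarith
  -- the event is contained in `B`
  have hsub : (univ.filter fun ω : Ωt => N * slyTsum n m' q lam strict Ep Em ω < ET / Real.sqrt n) ⊆ Bset := by
    intro ω hω
    rw [Finset.mem_filter] at hω
    rw [hBset, Finset.mem_filter]
    refine ⟨Finset.mem_univ _, ?_⟩
    by_contra hgood
    push Not at hgood
    -- lower bound for `T ω`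
    have hsq : 0 < Real.sqrt n := Real.sqrt_pos.2 hn0
    have hT : slyTsum n m' q lam strict Ep Em ω ≥ ∑ p ∈ Wset, w p * Zr ω p := by
      rw [slyTsum_eq_sum_region, ← hRset]
      exact Finset.sum_le_sum_of_subset_of_nonneg hWR fun p _ _ => mul_nonneg (hw0 p).le (hZr0 ω p)
    -- on the window: each term is at least its "good part"
    have hterm : ∀ p ∈ Wset, 2 / (Real.sqrt n * N) * (F p - (if bad ω p then F p else 0)) ≤ w p * Zr ω p := by
      intro p _
      by_cases hb : bad ω p
      · rw [if_pos hb, sub_self, mul_zero]; exact mul_nonneg (hw0 p).le (hZr0 ω p)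
      · rw [if_neg hb, sub_zero]
        have hb' : 2 / Real.sqrt n * ((∑ ω', Zr ω' p) / N) < Zr ω p := lt_of_not_ge hb
        have : 2 / (Real.sqrt n * N) * F p = w p * (2 / Real.sqrt n * ((∑ ω', Zr ω' p) / N)) := by
          rw [hF]; field_simp
        rw [this]
        exact mul_le_mul_of_nonneg_left hb'.le (hw0 p).le
    have hsumW : 2 / (Real.sqrt n * N) * (SW - ∑ p ∈ Wset, (if bad ω p then F p else 0)) ≤ ∑ p ∈ Wset, w p * Zr ω p := by
      rw [hSW, ← Finset.sum_sub_distrib, Finset.mul_sum]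
      exact Finset.sum_le_sum hterm
    have hchain : ET / Real.sqrt n ≤ N * slyTsum n m' q lam strict Ep Em ω := by
      have h1 : 2 / (Real.sqrt n * N) * (SW - 1 / 4 * SW) ≤ slyTsum n m' q lam strict Ep Em ω := by
        refine le_trans ?_ (le_trans hsumW hT)
        refine mul_le_mul_of_nonneg_left (by linarith) (by positivity)
      have h2 : ET / Real.sqrt n ≤ N * (2 / (Real.sqrt n * N) * (SW - 1 / 4 * SW)) := by
        rw [show N * (2 / (Real.sqrt n * N) * (SW - 1 / 4 * SW)) = (3 / 2 * SW) / Real.sqrt n by field_simp; ring]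
        exact div_le_div_of_nonneg_right hETle hsq.le
      exact h2.trans (mul_le_mul_of_nonneg_left h1 hNpos.le)
    linarith [hω.2]
  have hcard := Finset.card_le_card hsub
  have hcardR : ((univ.filter fun ω : Ωt => N * slyTsum n m' q lam strict Ep Em ω < ET / Real.sqrt n).card : ℝ) ≤ Bset.card := by
    exact_mod_cast hcard
  linarith

end Thm310Main

section HT6

open scoped Classical in
/-- **Sly's Theorem 3.10 (both phases, counting form = hypothesis `HT6` of
`slyGadgetReduction_of_thm310`) from the per-slice lower tail (Lemma 3.9).** The densities
`(p⁺, p⁻)` come from `exists_slyCriticalDensities`, the extra condition `(d-1) q⁺q⁻ < 1` of the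
second-moment analysis from `sly_extraCondition`; the minus phase is the strict plus phase of the
swapped boundary at the inverse realisation (`slyCoreZ_false_eq_slyTsum`). [cite: Sly2010, Theorem 3.10] -/
theorem sly_HT6_of_perSlice (q : ℕ) (hq : 2 ≤ q) (lam : ℝ) (hlam : hardCoreThreshold (q + 1) < lam)
    (HperSlice : ∀ {pp pm : ℝ}, 0 < pm → pm < pp → pp + pm < 1 →
      lam * (1 - pp - pm) ^ (q + 1) = pp * (1 - pp) ^ (q + 1 - 1) →
      lam * (1 - pp - pm) ^ (q + 1) = pm * (1 - pm) ^ (q + 1 - 1) →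
      (((q + 1 : ℕ) : ℝ) - 1) * pp * pm < (1 - pp) * (1 - pm) →
      ∀ {θ : ℝ}, 0 < θ →
      ∃ χ : ℝ, 0 < χ ∧ ∃ n₀ : ℕ, ∀ n : ℕ, n₀ ≤ n → ∀ m' : ℕ, (m' : ℝ) ≤ (n : ℝ) ^ (1 / 10 : ℝ) →
        ∀ (Ep Em : Finset (Fin m')) (a b : ℕ), |(a : ℝ) / n - pp| ≤ χ → |(b : ℝ) / n - pm| ≤ χ →
          ((univ.filter fun ω : (Fin q → Equiv.Perm (Fin (n + m'))) × Equiv.Perm (Fin n) =>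
              ((slyZab n m' q a b Ep Em ω : ℕ) : ℝ) ≤ 2 / Real.sqrt n *
                ((∑ ω' : (Fin q → Equiv.Perm (Fin (n + m'))) × Equiv.Perm (Fin n), ((slyZab n m' q a b Ep Em ω' : ℕ) : ℝ)) /
                  Fintype.card ((Fin q → Equiv.Perm (Fin (n + m'))) × Equiv.Perm (Fin n)))).card : ℝ) ≤
            θ * Fintype.card ((Fin q → Equiv.Perm (Fin (n + m'))) × Equiv.Perm (Fin n))) :
    ∃ γ₆ : ℝ, 0 < γ₆ ∧ ∃ n₆ : ℕ, ∀ n : ℕ, n₆ ≤ n → ∀ m' : ℕ, (m' : ℝ) ≤ (n : ℝ) ^ γ₆ →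
      ∀ (s : Bool) (Ep Em : Finset (Fin m')),
        16 * ((univ.filter fun ω : (Fin q → Equiv.Perm (Fin (n + m'))) × Equiv.Perm (Fin n) =>
          (Fintype.card ((Fin q → Equiv.Perm (Fin (n + m'))) × Equiv.Perm (Fin n)) : ℝ) * slyCoreZ ω.1 ω.2 lam s Ep Em <
            (∑ ω' : (Fin q → Equiv.Perm (Fin (n + m'))) × Equiv.Perm (Fin n), slyCoreZ ω'.1 ω'.2 lam s Ep Em) /
              Real.sqrt n).card : ℝ) ≤
          Fintype.card ((Fin q → Equiv.Perm (Fin (n + m'))) × Equiv.Perm (Fin n)) := by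
  have hd : 3 ≤ q + 1 := by omega
  have hlam0 : 0 < lam := (hardCoreThreshold_pos hd).trans hlam
  obtain ⟨pp, pm, qp, qm, hpm, hlt, hsum, hEα, hEβ, hqm, hqlt, hqp1, hqp_eq, hqm_eq, hqp_rec, hqm_rec⟩ :=
    exists_slyCriticalDensities hd hlam
  simp only [Nat.add_sub_cancel] at hEα hEβ hqp_rec hqm_rec
  have hpp : 0 < pp := hpm.trans hlt
  -- the extra condition `(d-1) q⁺ q⁻ < 1`, in terms of the densities
  have hext := sly_extraCondition (d := q + 1) hd hlam0 hqm hqlt hqp1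
    (by simp only [Nat.add_sub_cancel]; rw [hcPhi_eq]; exact hqp_rec)
    (by simp only [Nat.add_sub_cancel]; rw [hcPhi_eq]; exact hqm_rec)
  have hρ : (((q + 1 : ℕ) : ℝ) - 1) * pp * pm < (1 - pp) * (1 - pm) := by
    have h1 : 0 < 1 - pp := by linarith
    have h2 : 0 < 1 - pm := by linarith
    have hprod : qp * qm = pp * pm / ((1 - pm) * (1 - pp)) := by rw [hqp_eq, hqm_eq]; field_simp
    rw [hprod] at hext
    have hq0 : (0 : ℝ) ≤ ((q + 1 : ℕ) : ℝ) - 1 := by push_cast; linarith [(Nat.cast_nonneg q : (0:ℝ) ≤ q)]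
    rw [← mul_div_assoc, div_lt_one (mul_pos h2 h1)] at hext
    linarith [hext]
  have hEα' : lam * (1 - pp - pm) ^ (q + 1) = pp * (1 - pp) ^ (q + 1 - 1) := by simpa only [Nat.add_sub_cancel] using hEα
  have hEβ' : lam * (1 - pp - pm) ^ (q + 1) = pm * (1 - pm) ^ (q + 1 - 1) := by simpa only [Nat.add_sub_cancel] using hEβ
  -- the per-slice input at `θ = 1/64`
  have Hslice := HperSlice hpm hlt hsum hEα' hEβ' hρ (θ := 1 / 64) (by norm_num)
  obtain ⟨γ, hγ, n₆, hmain⟩ := sly_Tsum_lowerTail_of_slice q hq hlam hpm hlt hsum hEα' hEβ' Hslice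
  refine ⟨γ, hγ, n₆, fun n hn m' hm' s Ep Em => ?_⟩
  cases s
  · -- minus phase: strict plus phase of the swapped boundary at the inverse realisation
    have h := hmain n hn m' hm' true Em Ep
    have hsum' : (∑ ω' : (Fin q → Equiv.Perm (Fin (n + m'))) × Equiv.Perm (Fin n), slyCoreZ ω'.1 ω'.2 lam false Ep Em) =
        ∑ ω' : (Fin q → Equiv.Perm (Fin (n + m'))) × Equiv.Perm (Fin n), slyTsum n m' q lam true Em Ep ω' := by
      simp_rw [slyCoreZ_false_eq_slyTsum]
      exact sum_slyInvReal_comp (fun ω => slyTsum n m' q lam true Em Ep ω)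
    rw [hsum']
    simp_rw [slyCoreZ_false_eq_slyTsum]
    have e := card_filter_slyInvReal_comp (n := n) (m' := m') (q := q)
      (fun ω => (Fintype.card ((Fin q → Equiv.Perm (Fin (n + m'))) × Equiv.Perm (Fin n)) : ℝ) *
        slyTsum n m' q lam true Em Ep ω < (∑ ω', slyTsum n m' q lam true Em Ep ω') / Real.sqrt n)
    rw [e]
    exact h
  · -- plus phase
    have h := hmain n hn m' hm' false Ep Em
    simp_rw [slyCoreZ_true_eq_slyTsum]
    exact h

end HT6

section Glue

variable {q : ℕ}

/-- **The window regime**: in a `g/4`-window (`g = 1 - p⁺ - p⁻`) and for `m' ≤ n^{1/10}`, `n` large,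
`a + b + m' ≤ n`. [folklore] -/
theorem sly_window_regime {pp pm : ℝ} (hpm : 0 < pm) (hlt : pm < pp) (hsum : pp + pm < 1) :
    ∃ χ : ℝ, 0 < χ ∧ ∃ n₀ : ℕ, ∀ n : ℕ, n₀ ≤ n → ∀ m' : ℕ, (m' : ℝ) ≤ (n : ℝ) ^ (1 / 10 : ℝ) →
      ∀ a b : ℕ, |(a : ℝ) / n - pp| ≤ χ → |(b : ℝ) / n - pm| ≤ χ → a + b + m' ≤ n ∧ 0 < a ∧ 0 < b := by
  set g : ℝ := 1 - pp - pm with hg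
  have hg0 : 0 < g := by rw [hg]; linarith
  refine ⟨min (g / 4) (pm / 2), lt_min (by linarith) (by linarith), ?_⟩
  have T9 : Tendsto (fun n : ℕ => (n : ℝ) ^ (-(9 / 10) : ℝ)) atTop (𝓝 0) :=
    (tendsto_rpow_neg_atTop (by norm_num)).comp tendsto_natCast_atTop_atTop
  have E1 : ∀ᶠ n : ℕ in atTop, (n : ℝ) ^ (-(9 / 10) : ℝ) ≤ g / 2 := T9.eventually_le_const (by linarith)
  have E0 : ∀ᶠ n : ℕ in atTop, 1 ≤ n := eventually_ge_atTop 1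
  obtain ⟨n₀, hn₀⟩ := Filter.eventually_atTop.1 (E0.and E1)
  refine ⟨n₀, fun n hn m' hm' a b ha hb => ?_⟩
  obtain ⟨e0, e1⟩ := hn₀ n hn
  have hn1 : (1 : ℝ) ≤ n := by exact_mod_cast e0
  have hn0 : (0 : ℝ) < n := by linarith
  have hrpow : (n : ℝ) ^ (1 / 10 : ℝ) = (n : ℝ) ^ (-(9 / 10) : ℝ) * n := by
    rw [show (1 / 10 : ℝ) = -(9 / 10) + 1 by norm_num, Real.rpow_add hn0, Real.rpow_one]
  have hm'g : (m' : ℝ) ≤ g / 2 * n := by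
    rw [hrpow] at hm'; exact hm'.trans (mul_le_mul_of_nonneg_right e1 hn0.le)
  have hχg : min (g / 4) (pm / 2) ≤ g / 4 := min_le_left _ _
  have hχp : min (g / 4) (pm / 2) ≤ pm / 2 := min_le_right _ _
  have ha' := abs_le.1 ha
  have hb' := abs_le.1 hb
  have ha_hi : (a : ℝ) ≤ (pp + g / 4) * n := by
    have : (a : ℝ) / n ≤ pp + g / 4 := by linarith [ha'.2]
    rwa [div_le_iff₀ hn0] at this
  have hb_hi : (b : ℝ) ≤ (pm + g / 4) * n := by
    have : (b : ℝ) / n ≤ pm + g / 4 := by linarith [hb'.2]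
    rwa [div_le_iff₀ hn0] at this
  have ha_lo : (pm / 2) * n ≤ a := by
    have : pm / 2 ≤ (a : ℝ) / n := by linarith [ha'.1]
    rwa [le_div_iff₀ hn0] at this
  have hb_lo : (pm / 2) * n ≤ b := by
    have : pm / 2 ≤ (b : ℝ) / n := by linarith [hb'.1]
    rwa [le_div_iff₀ hn0] at this
  have hgn : g * n = n - pp * n - pm * n := by rw [hg]; ring
  refine ⟨?_, ?_, ?_⟩
  · have : (a : ℝ) + b + m' ≤ n := by linarith
    exact_mod_cast this
  · have : (0 : ℝ) < a := lt_of_lt_of_le (by positivity) ha_lo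
    exact_mod_cast this
  · have : (0 : ℝ) < b := lt_of_lt_of_le (by positivity) hb_lo
    exact_mod_cast this

/-- **Positivity of the first moment on the window.** [folklore] -/
theorem sly_sum_slyZab_pos_window (q : ℕ) {pp pm : ℝ} (hpm : 0 < pm) (hlt : pm < pp) (hsum : pp + pm < 1) :
    ∃ χ : ℝ, 0 < χ ∧ ∃ n₀ : ℕ, ∀ n : ℕ, n₀ ≤ n → ∀ m' : ℕ, (m' : ℝ) ≤ (n : ℝ) ^ (1 / 10 : ℝ) →
      ∀ (Ep Em : Finset (Fin m')) (a b : ℕ), |(a : ℝ) / n - pp| ≤ χ → |(b : ℝ) / n - pm| ≤ χ →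
        0 < ∑ ω : (Fin q → Equiv.Perm (Fin (n + m'))) × Equiv.Perm (Fin n), ((slyZab n m' q a b Ep Em ω : ℕ) : ℝ) := by
  obtain ⟨χ, hχ, n₀, hreg⟩ := sly_window_regime hpm hlt hsum
  refine ⟨χ, hχ, n₀, fun n hn m' hm' Ep Em a b ha hb => ?_⟩
  obtain ⟨habm, -, -⟩ := hreg n hn m' hm' a b ha hb
  have hep : Ep.card ≤ m' := by simpa using Finset.card_le_univ Ep
  have hem : Em.card ≤ m' := by simpa using Finset.card_le_univ Em
  rw [sum_slyZab_eq n m' q a b Ep Em (by omega) (by omega) (by omega) (by omega)]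
  have c0 : (0 : ℝ) < (((n + m') ! : ℕ) : ℝ) ^ q * ((n ! : ℕ) : ℝ) := by
    have h1 : (0 : ℝ) < (((n + m') ! : ℕ) : ℝ) := by exact_mod_cast Nat.factorial_pos _
    have h2 : (0 : ℝ) < ((n ! : ℕ) : ℝ) := by exact_mod_cast Nat.factorial_pos _
    positivity
  have c1 : 0 < (n.choose a : ℝ) := by exact_mod_cast Nat.choose_pos (by omega)
  have c2 : 0 < (n.choose b : ℝ) := by exact_mod_cast Nat.choose_pos (by omega)
  have c3 : 0 < (((n + m') - (b + Em.card)).choose (a + Ep.card) : ℝ) := by exact_mod_cast Nat.choose_pos (by omega)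
  have c4 : 0 < ((n + m').choose (a + Ep.card) : ℝ) := by exact_mod_cast Nat.choose_pos (by omega)
  have c5 : 0 < ((n - b).choose a : ℝ) := by exact_mod_cast Nat.choose_pos (by omega)
  positivity

/-- **The second-moment input (S) of the per-slice bound, from the ratio identity and the ratio bound.**
[cite: Sly2010, Lemma 3.5 and proof of Theorem 3.10] -/
theorem sly_secondMoment_input (q : ℕ) {pp pm : ℝ} (hpm : 0 < pm) (hlt : pm < pp) (hsum : pp + pm < 1)
    (R : ℕ → ℕ → ℕ → ℕ → ℕ → ℕ → ℕ → ℝ) (τ : ℝ)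
    (HR3 : ∀ ε : ℝ, 0 < ε → ∃ χ : ℝ, 0 < χ ∧ ∃ n₀ : ℕ, ∀ n : ℕ, n₀ ≤ n →
      ∀ mm : ℕ, (mm : ℝ) ≤ (n : ℝ) ^ (1 / 10 : ℝ) →
      ∀ a b ep em : ℕ, ep ≤ mm → em ≤ mm → |(a : ℝ) / n - pp| ≤ χ → |(b : ℝ) / n - pm| ≤ χ →
        R n (n + mm) q a b ep em ≤ (1 + ε) * τ)
    (HLink : ∀ (n m' a b : ℕ) (Ep Em : Finset (Fin m')), a + b ≤ n → (a + Ep.card) + (b + Em.card) ≤ n + m' →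
      ((((n + m') ! : ℕ) : ℝ) ^ q * ((n ! : ℕ) : ℝ)) *
          ∑ ω : (Fin q → Equiv.Perm (Fin (n + m'))) × Equiv.Perm (Fin n), ((slyZab n m' q a b Ep Em ω : ℕ) : ℝ) ^ 2 =
        (∑ ω : (Fin q → Equiv.Perm (Fin (n + m'))) × Equiv.Perm (Fin n), ((slyZab n m' q a b Ep Em ω : ℕ) : ℝ)) ^ 2 *
          R n (n + m') q a b Ep.card Em.card) :
    ∀ ε : ℝ, 0 < ε → ∃ χ : ℝ, 0 < χ ∧ ∃ n₀ : ℕ, ∀ n : ℕ, n₀ ≤ n → ∀ m' : ℕ, (m' : ℝ) ≤ (n : ℝ) ^ (1 / 10 : ℝ) →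
      ∀ (Ep Em : Finset (Fin m')) (a b : ℕ), |(a : ℝ) / n - pp| ≤ χ → |(b : ℝ) / n - pm| ≤ χ →
        (Fintype.card ((Fin q → Equiv.Perm (Fin (n + m'))) × Equiv.Perm (Fin n)) : ℝ) *
            ∑ ω : (Fin q → Equiv.Perm (Fin (n + m'))) × Equiv.Perm (Fin n), ((slyZab n m' q a b Ep Em ω : ℕ) : ℝ) ^ 2 ≤
          (1 + ε) * τ *
            (∑ ω : (Fin q → Equiv.Perm (Fin (n + m'))) × Equiv.Perm (Fin n), ((slyZab n m' q a b Ep Em ω : ℕ) : ℝ)) ^ 2 := by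
  intro ε hε
  obtain ⟨χ₁, hχ₁, n₁, h₁⟩ := HR3 ε hε
  obtain ⟨χ₂, hχ₂, n₂, h₂⟩ := sly_window_regime hpm hlt hsum
  refine ⟨min χ₁ χ₂, lt_min hχ₁ hχ₂, max n₁ n₂, fun n hn m' hm' Ep Em a b ha hb => ?_⟩
  have hep : Ep.card ≤ m' := by simpa using Finset.card_le_univ Ep
  have hem : Em.card ≤ m' := by simpa using Finset.card_le_univ Em
  obtain ⟨habm, -, -⟩ := h₂ n (le_trans (le_max_right _ _) hn) m' hm' a b (ha.trans (min_le_right _ _)) (hb.trans (min_le_right _ _))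
  have hR := h₁ n (le_trans (le_max_left _ _) hn) m' hm' a b Ep.card Em.card hep hem (ha.trans (min_le_left _ _)) (hb.trans (min_le_left _ _))
  have hL := HLink n m' a b Ep Em (by omega) (by omega)
  rw [card_realisations']
  rw [hL]
  have hsq : 0 ≤ (∑ ω : (Fin q → Equiv.Perm (Fin (n + m'))) × Equiv.Perm (Fin n), ((slyZab n m' q a b Ep Em ω : ℕ) : ℝ)) ^ 2 := sq_nonneg _
  calc _ ≤ (∑ ω : (Fin q → Equiv.Perm (Fin (n + m'))) × Equiv.Perm (Fin n), ((slyZab n m' q a b Ep Em ω : ℕ) : ℝ)) ^ 2 *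
        ((1 + ε) * τ) := mul_le_mul_of_nonneg_left hR hsq
    _ = _ := by ring

end Glue

end Literature.Computability.Complexity
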